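import Mathlib.AlgebraicGeometry.Morphisms.Etale
import Mathlib.AlgebraicGeometry.Morphisms.Separated
import Mathlib.AlgebraicGeometry.Morphisms.FiniteType
import Mathlib.AlgebraicGeometry.Morphisms.QuasiCompact
import Mathlib.AlgebraicGeometry.Properties
import Mathlib.RingTheory.GradedAlgebra.Basic
import Mathlib.RingTheory.Smooth.Basic
import Mathlib.RingTheory.FiniteType
import Mathlib.FieldTheory.Perfect
import Literature.AlgebraicGeometry.Resolution.ResolutionOfSingularities
import HarnessLib

/-!
# Resolution of finite tame (diagonalizable) quotient singularities (Bergh–Rydh 2019, Thm 5)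

Topic: `Literature/AlgebraicGeometry/Resolution`. A NAMED FACT used by the route
`ResolutionOfSingularities/WeightedInvariant` (crux `DatumToEmbedded`, the torus-quotient end game
of Włodarczyk's cobordant tower, arXiv:2203.03090 p. 3: "The output is a smooth scheme with a
torus action whose geometric quotient has abelian quotient singularities. These can be resolved
canonically by toroidal methods [Wło20] or by the destackification algorithm of Bergh and Rydh
[BR19]").

D. Bergh, D. Rydh, *Functorial destackification and weak factorization of orbifolds*,
arXiv:1905.00872, Theorem 5 ("Resolution of tame quotient singularities"): "Let `k` be a perfect
field and let `X` be a variety over `k` with finite tame quotient singularities. Then there exists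
a sequence of blow-ups `X' = X_n → X_{n-1} → ⋯ → X_1 → X_0 = X` such that `X'/k` is smooth.
Moreover, this sequence is functorial with respect to field extensions and smooth morphisms
`X' → X`", with the definition preceding it: "Let `k` be a perfect field, and let `X` be an
integral scheme over `k`. We say that `X` has finite tame quotient singularities if étale-locally
on `X`, there exists a finite linearly reductive group scheme `G` over `k` and `G`-scheme `U`,
smooth over `k`, such that `X = U/G`." (Proof there: Satriano's canonical stack + destackification,
Thm 2; an independent proof in the tame étale case is Buonerba, arXiv:1511.00550.)

## What is recorded (a special case, in Mathlib's vocabulary)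

* The groups are DIAGONALIZABLE: `G = D(A) = Spec k[A]` for a finite abelian group `A`. Such a
  `G` is finite and linearly reductive over every field (it is of multiplicative type; `μ_{pᵉ}` in
  characteristic `p` included) — exactly the stabilisers of torus actions. An action of `D(A)` on
  an affine `k`-scheme `U = Spec S` is the same as an `A`-grading `S = ⊕_{a ∈ A} S_a` of the
  `k`-algebra `S` (Mathlib `GradedAlgebra 𝒮`, `𝒮 : A → Submodule k S`), and the quotient is
  `U/G = Spec S^G = Spec S₀` (`𝒮 0`, a `k`-algebra by `SetLike.GradeZero.instAlgebra`).
* "étale-locally `X = U/G`" is recorded pointwise: every point of `X` lies in the image of an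
  ÉTALE `k`-morphism `U/G = Spec S₀ → X` — so the `Spec S₀ → X` form an étale covering of `X` by
  quotients `U/G`, which is the printed hypothesis.
* "variety" = integral, separated, of finite type over `k`; "smooth over `k`" = Mathlib
  `Algebra.Smooth k S` (with `Algebra.FiniteType k S`).
* The conclusion is recorded in the weak form of this topic, `Scheme.HasResolution X` (some proper
  birational morphism onto `X` from a regular scheme); printed: a blow-up sequence ending in a
  smooth `X'`, functorial — stronger on every count.

Users take `(h : BerghRydh2019_diagonalizableQuotientResolution)`; discharging it is a
formalisation of tame destackification (or of toroidal resolution of simplicial toric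
singularities glued over a variety) and is not attempted here.

-- TODO(general form): arbitrary finite linearly reductive `G`, étale-local presentations
-- `X ← X₁ → U/G`, the blow-up sequence and its functoriality.

## Also recorded: constant tame groups (`BerghRydh2019_tameQuotientResolution`)

The second special case of the same printed theorem, wanted by the routes
`ResolutionOfSingularities/WildQuotient(s)` (items `TameQuotientResolution`,
`WildQuotientResolution`, whose charts are spectra of invariant rings `S^G` of a finite ABSTRACT
group `G` acting on a regular finitely generated `k`-algebra `S`): the group is the CONSTANT group
scheme of a finite group `G` whose order is invertible in `k` — linearly reductive by Maschke's
theorem (and only then) — acting on the smooth affine `U = Spec S` through `MulSemiringAction G S`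
by `k`-algebra automorphisms (`SMulCommClass G k S`); the quotient is `U/G = Spec S^G` with
`S^G = FixedPoints.subalgebra k S G` (Mumford, *Abelian Varieties*, §7, Theorem p. 66); the charts
`Spec S^G → X` are étale `k`-morphisms covering `X`, and the conclusion is again
`Scheme.HasResolution X`. Neither special case contains the other (a diagonalizable `D(A)` with
`p ∣ |A|` is not étale; a non-abelian `G` is not diagonalizable).
-/

noncomputable section

open CategoryTheory AlgebraicGeometry

namespace Literature.AlgebraicGeometry.Resolution

/-- NAMED FACT — **Bergh–Rydh 2019, Theorem 5 (resolution of finite tame quotient singularities),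
diagonalizable case**: let `k` be a perfect field and `X` an integral separated `k`-scheme of finite
type such that every point of `X` lies in the image of an étale `k`-morphism
`Spec S₀ → X`, where `S` is a finitely generated smooth `k`-algebra graded by a finite abelian
group `A` and `S₀` is its degree-`0` part (i.e. `Spec S₀ = U/G` for the finite diagonalizable —
hence linearly reductive — group scheme `G = Spec k[A]` acting on the smooth affine `U = Spec S`);
then `X` admits a resolution of singularities (printed: "there exists a sequence of blow-ups
`X' = X_n → ⋯ → X_0 = X` such that `X'/k` is smooth … functorial with respect to field extensions
and smooth morphisms"; recorded: `Scheme.HasResolution X`).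
[cite: BerghRydh2019, Thm 5 and the definition preceding it (arXiv:1905.00872, p. 4)] -/
def BerghRydh2019_diagonalizableQuotientResolution : Prop :=
  ∀ (k : Type) [Field k] [PerfectField k] (X : Scheme.{0}) (g : X ⟶ Spec (.of k))
    [IsIntegral X] [IsSeparated g] [LocallyOfFiniteType g] [QuasiCompact g],
    (∀ x : X, ∃ (A : Type) (_ : AddCommGroup A) (_ : Finite A) (_ : DecidableEq A)
        (S : Type) (_ : CommRing S) (_ : Algebra k S) (𝒮 : A → Submodule k S)
        (_ : GradedAlgebra 𝒮), Algebra.FiniteType k S ∧ Algebra.Smooth k S ∧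
        ∃ φ : Spec (.of (𝒮 0)) ⟶ X, Etale φ ∧ x ∈ Set.range φ ∧
          φ ≫ g = Spec.map (CommRingCat.ofHom (algebraMap k (𝒮 0)))) →
    Scheme.HasResolution X

/-- NAMED FACT — **Bergh–Rydh 2019, Theorem 5 (resolution of finite tame quotient singularities),
case of constant tame groups**: let `k` be a perfect field and `X` an integral separated
`k`-scheme of finite type such that every point of `X` lies in the image of an étale `k`-morphism
`Spec S^G → X`, where `S` is a finitely generated smooth `k`-algebra, `G` is a finite (abstract)
group whose order is invertible in `k` acting on `S` by `k`-algebra automorphisms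
(`MulSemiringAction G S`, `SMulCommClass G k S`), and `S^G = FixedPoints.subalgebra k S G` is the
ring of invariants — i.e. `Spec S^G = U/G` (Mumford, *Abelian Varieties*, §7, Thm. p. 66) for the
CONSTANT finite group scheme `G_k`, which is linearly reductive precisely when `|G| ∈ kˣ`
(Maschke), acting on the smooth affine `U = Spec S`; so `X` "has finite tame quotient
singularities" in the printed sense ("étale-locally on `X`, there exists a finite linearly
reductive group scheme `G` over `k` and `G`-scheme `U`, smooth over `k`, such that `X = U/G`").
Then `X` admits a resolution of singularities (printed: "there exists a sequence of blow-ups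
`X' = X_n → ⋯ → X_0 = X` such that `X'/k` is smooth. Moreover, this sequence is functorial with
respect to field extensions and smooth morphisms"; recorded, weaker: `Scheme.HasResolution X`).
The companion `BerghRydh2019_diagonalizableQuotientResolution` records the diagonalizable
stabilisers `D(A)`; this one the constant groups of invertible order (in particular every finite
group of order prime to `p = char k`, wild `p`-groups excluded), as wanted by the routes
`ResolutionOfSingularities/WildQuotient(s)` (items `TameQuotientResolution`,
`WildQuotientResolution`: charts `Spec S^G`). Over the perfect field `k`, "`S` smooth over `k`" is
the same as "`S` regular" for finitely generated `S` (`smooth_of_isRegular_of_perfectField`,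
`SmoothOfRegularPerfectField.lean`); open immersions are étale, so Zariski-local charts qualify.
Users take `(h : BerghRydh2019_tameQuotientResolution)`; discharging it is a formalisation of tame
destackification (Bergh–Rydh Thm. 2 with Satriano's canonical stack), not attempted here.
-- TODO(general form): arbitrary finite linearly reductive group SCHEMES (extensions of constant
-- tame groups by diagonalizable ones, étale-locally), algebraic spaces `X`, the blow-up sequence
-- and its functoriality.
[cite: BerghRydh2019, Thm 5 and the definition preceding it (arXiv:1905.00872, p. 4)] -/
def BerghRydh2019_tameQuotientResolution : Prop :=
  ∀ (k : Type) [Field k] [PerfectField k] (X : Scheme.{0}) (g : X ⟶ Spec (.of k))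
    [IsIntegral X] [IsSeparated g] [LocallyOfFiniteType g] [QuasiCompact g],
    (∀ x : X, ∃ (G : Type) (_ : Group G) (_ : Finite G) (S : Type) (_ : CommRing S)
        (_ : Algebra k S) (_ : MulSemiringAction G S) (_ : SMulCommClass G k S),
        (Nat.card G : k) ≠ 0 ∧ Algebra.FiniteType k S ∧ Algebra.Smooth k S ∧
        ∃ φ : Spec (.of (FixedPoints.subalgebra k S G)) ⟶ X, Etale φ ∧ x ∈ Set.range φ.base ∧
          φ ≫ g = Spec.map (CommRingCat.ofHom (algebraMap k (FixedPoints.subalgebra k S G)))) →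
    Scheme.HasResolution X

end Literature.AlgebraicGeometry.Resolution

end
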